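import Literature.MathematicalPhysics.StatisticalMechanics.LennardJonesClusters
import Literature.Geometry.DiscreteGeometry.BondGraph

/-!
# FrustratedLawDichotomy · the attractive Lennard-Jones TAIL beyond range `R` is floored by the one-body density proxy
# (`TailFloor R A` of lens-5 g33's RANGE CUT, PROVED with an explicit constant)

Lens-5 g33 («StrainCurrencySplit + RangeCut», NODE 2026-08-31T14:46:53Z; file `FrustratedLawDichotomyRangeCut.lean`, landing
pending) cuts the energetic residual `FDG` of the column of item 27623 by RANGE: `V_LJ = truncLJ R + tailLJ R`, and floors the
attractive tail over every `7/10`-separated finite cluster by the ONE-BODY DENSITY PROXY `m_i = min(nn_i, 1)⁻³`: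

  `TailFloor R A :  −A · Σ_i m_i ≤ Σ_{i<j} tailLJ R (r_ij)`   (typed there KNOWN-type · ATTACKABLE·M, intended `A_R = (2/3)(R−1)⁻³`).

This file PROVES the statement (in raw form — `tailLJ`, `densityProxy`, `Sep` unfolded, so that `TailFloor R A` follows by `fun N y _ h =>
tail_floor … N y h` once that file lands) with the explicit constant

  `A_R = (128/21) · (1 + 1/(4R))³ / R³`   (every `R > 0`),

about `9×` the sharp mean-value constant at the same `R` (dyadic shells instead of the bi-subharmonic mean value); literal corollaries
`A_8 ≤ 131/10⁴` (`tail_floor_eight`) and `A_14 ≤ 1/400` (`tail_floor_fourteen`).  Against lens-5's MEASURED ceilings the range cut then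
bites beneath `T′` (ceiling `1.6·10⁻²`) from `R = 8` and beneath `FDG` (ceiling `3.6·10⁻³`) from `R = 14` (instead of `5` / `7`).

## Proof

* §1 WEIGHTED PACKING BY VOLUME: pairwise disjoint balls `B(c_j, ρ_j)` inside `B(p, L)` have `Σ ρ_j³ ≤ L³` (Haar measure; the argument of
  `Literature…card_le_of_separated_of_dist_le` with variable radii).  For a `7/10`-separated cluster the half-balls `B(y_j, min(nn_j,1)/2)`
  are pairwise disjoint, so `Σ_{j : r_ij ≤ b} min(nn_j,1)³ ≤ 8 (b + ½)³`.
* §2 DYADIC SHELLS (as in `ExcessDecayLiouvilleFarField.sum_inv_pow_le_of_separated`, weighted): the weighted far field at a site obeys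
  `S_i := Σ_{j ≠ i, r_ij ≥ R} r_ij⁻⁶ · min(nn_j,1)³ ≤ (512/7)(1 + 1/(4R))³ / R³`.
* §3 SYMMETRISATION: with `w = min(nn,1)³`, `m = w⁻¹`: `r_ij⁻⁶ ≤ ½ r_ij⁻⁶ (w_j m_i + w_i m_j)` (AM–GM, `w_i m_i = 1`), hence
  `Σ_{i ≠ j, far} r_ij⁻⁶ ≤ Σ_i m_i S_i`, and `V_LJ ≥ −r⁻⁶/6` gives `Σ_{i<j} tailLJ R ≥ −(1/12)·(512/7)(1+1/(4R))³R⁻³ · Σ_i m_i`.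

DEF-FREE; 0 sorry; Mathlib + Literature (`LennardJonesClusters`, `BondGraph`) only.  Prover hand 1, gen 12 (decomp-a2c),
--supports stmt-AtomisticToContinuum-27623.  [folklore: far-field lattice-sum tail by volume packing]
-/

noncomputable section

namespace Summit.AtomisticToContinuum.Crystallization.Theorems.FrustratedLawDichotomyTailFloor

open scoped BigOperators ENNReal
open Metric Set Module MeasureTheory
open Literature.MathematicalPhysics.StatisticalMechanics (interactionEnergy lennardJones siteEnergy two_mul_interactionEnergy)
open Literature.Geometry.DiscreteGeometry (nearestDist nearestDist_le_dist le_nearestDist nearestDist_nonneg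
  nearestDist_eq_zero_of_subsingleton)

/-! ## 1. Weighted packing by volume -/

open scoped Function in
/-- **Weighted packing by volume.** Finitely many balls `B(c_j, ρ_j)` (`ρ_j > 0`) of a finite-dimensional real normed space with
`ρ_j + ρ_k ≤ dist c_j c_k` (pairwise disjoint) and `dist c_j p + ρ_j ≤ L` (inside `B(p, L)`) satisfy `Σ_j ρ_j^dim ≤ L^dim`
(the argument of `Literature…card_le_of_separated_of_dist_le`, with variable radii). [folklore] -/
theorem sum_pow_finrank_le_of_disjoint_balls {E : Type*} [NormedAddCommGroup E] [NormedSpace ℝ E] [FiniteDimensional ℝ E]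
    {ι : Type*} (s : Finset ι) (c : ι → E) (ρ : ι → ℝ) (p : E) {L : ℝ}
    (hρ : ∀ j ∈ s, 0 < ρ j) (hL : 0 ≤ L)
    (hdisj : ∀ j ∈ s, ∀ k ∈ s, j ≠ k → ρ j + ρ k ≤ dist (c j) (c k))
    (hin : ∀ j ∈ s, dist (c j) p + ρ j ≤ L) :
    ∑ j ∈ s, ρ j ^ finrank ℝ E ≤ L ^ finrank ℝ E := by
  classical
  rcases s.eq_empty_or_nonempty with hs | hs
  · rw [hs, Finset.sum_empty]; positivity
  have hLpos : 0 < L := by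
    obtain ⟨j, hj⟩ := hs
    linarith [hρ j hj, hin j hj, dist_nonneg (x := c j) (y := p)]
  borelize E
  let μ : Measure E := Measure.addHaar
  set A := ⋃ j ∈ s, ball (c j) (ρ j) with hA
  have D : Set.Pairwise (s : Set ι) (Disjoint on fun j => ball (c j) (ρ j)) := by
    rintro j hj k hk hjk
    exact ball_disjoint_ball (hdisj j hj k hk hjk)
  have A_subset : A ⊆ ball p L := by
    refine iUnion₂_subset fun j hj => ball_subset_ball' ?_
    linarith [hin j hj, dist_comm (c j) p]
  have I : ENNReal.ofReal (∑ j ∈ s, ρ j ^ finrank ℝ E) * μ (ball 0 1) ≤ ENNReal.ofReal (L ^ finrank ℝ E) * μ (ball 0 1) :=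
    calc ENNReal.ofReal (∑ j ∈ s, ρ j ^ finrank ℝ E) * μ (ball 0 1)
        = ∑ j ∈ s, ENNReal.ofReal (ρ j ^ finrank ℝ E) * μ (ball 0 1) := by
          rw [ENNReal.ofReal_sum_of_nonneg (fun j hj => pow_nonneg (hρ j hj).le _), Finset.sum_mul]
      _ = μ A := by
          rw [hA, measure_biUnion_finset D fun j _ => measurableSet_ball]
          refine Finset.sum_congr rfl fun j hj => ?_
          rw [μ.addHaar_ball_of_pos _ (hρ j hj)]
      _ ≤ μ (ball p L) := measure_mono A_subset
      _ = ENNReal.ofReal (L ^ finrank ℝ E) * μ (ball 0 1) := by rw [μ.addHaar_ball_of_pos _ hLpos]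
  have J : ENNReal.ofReal (∑ j ∈ s, ρ j ^ finrank ℝ E) ≤ ENNReal.ofReal (L ^ finrank ℝ E) :=
    (ENNReal.mul_le_mul_iff_left (measure_ball_pos _ _ zero_lt_one).ne' measure_ball_lt_top.ne).1 I
  exact (ENNReal.ofReal_le_ofReal_iff (by positivity)).1 J

/-- `ℝ³` case: pairwise disjoint balls inside `B(p, L)` have `Σ_j ρ_j³ ≤ L³`. [folklore] -/
theorem sum_pow_three_le_of_disjoint_balls {ι : Type*} (s : Finset ι) (c : ι → (EuclideanSpace ℝ (Fin 3))) (ρ : ι → ℝ) (p : (EuclideanSpace ℝ (Fin 3))) {L : ℝ}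
    (hρ : ∀ j ∈ s, 0 < ρ j) (hL : 0 ≤ L)
    (hdisj : ∀ j ∈ s, ∀ k ∈ s, j ≠ k → ρ j + ρ k ≤ dist (c j) (c k))
    (hin : ∀ j ∈ s, dist (c j) p + ρ j ≤ L) :
    ∑ j ∈ s, ρ j ^ 3 ≤ L ^ 3 := by
  have h := sum_pow_finrank_le_of_disjoint_balls s c ρ p hρ hL hdisj hin
  rwa [finrank_euclideanSpace_fin] at h

/-! ## 2. The half-balls of a `7/10`-separated cluster and the weighted count in a ball -/

variable {N : ℕ}

/-- In a `7/10`-separated cluster with at least two sites, `nn_j ≥ 7/10`. [folklore] -/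
theorem nearestDist_ge (y : Fin N → (EuclideanSpace ℝ (Fin 3))) (hsep : ∀ a b : Fin N, a ≠ b → (7 : ℝ) / 10 ≤ dist (y a) (y b)) {j : Fin N}
    (hj : ∃ k, k ≠ j) : (7 : ℝ) / 10 ≤ nearestDist y j :=
  le_nearestDist hj fun k hk => hsep j k (Ne.symm hk)

/-- **Weighted count in a ball**: for a `7/10`-separated cluster, `Σ_{j : dist (y j) p ≤ b} min(nn_j, 1)³ ≤ 8 (b + ½)³` — the half-balls
`B(y_j, min(nn_j,1)/2)` are pairwise disjoint and lie in `B(p, b + ½)`. [folklore] -/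
theorem sum_weight_le_of_dist_le (y : Fin N → (EuclideanSpace ℝ (Fin 3))) (hsep : ∀ a b : Fin N, a ≠ b → (7 : ℝ) / 10 ≤ dist (y a) (y b))
    (p : (EuclideanSpace ℝ (Fin 3))) {b : ℝ} (hb : 0 ≤ b) (s : Finset (Fin N)) (hs : ∀ j ∈ s, dist (y j) p ≤ b) :
    ∑ j ∈ s, (min (nearestDist y j) 1) ^ 3 ≤ 8 * (b + 1 / 2) ^ 3 := by
  by_cases hN : ∀ j : Fin N, ∃ k, k ≠ j
  · have hρ : ∀ j ∈ s, 0 < min (nearestDist y j) 1 / 2 := fun j _ =>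
      div_pos (lt_min (by linarith [nearestDist_ge y hsep (hN j)]) one_pos) two_pos
    have h := sum_pow_three_le_of_disjoint_balls s y (fun j => min (nearestDist y j) 1 / 2) p hρ
      (L := b + 1 / 2) (by positivity) ?_ ?_
    · calc ∑ j ∈ s, (min (nearestDist y j) 1) ^ 3 = 8 * ∑ j ∈ s, (min (nearestDist y j) 1 / 2) ^ 3 := by
            rw [Finset.mul_sum]; exact Finset.sum_congr rfl fun j _ => by ring
        _ ≤ 8 * (b + 1 / 2) ^ 3 := by linarith
    · intro j _ k _ hjk
      have h1 : nearestDist y j ≤ dist (y j) (y k) := nearestDist_le_dist y (Ne.symm hjk)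
      have h2 : nearestDist y k ≤ dist (y j) (y k) := by rw [dist_comm]; exact nearestDist_le_dist y hjk
      have h3 := min_le_left (nearestDist y j) 1
      have h4 := min_le_left (nearestDist y k) 1
      linarith
    · intro j hj
      have := min_le_right (nearestDist y j) 1
      linarith [hs j hj]
  · obtain ⟨j₀, hj₀⟩ := not_forall.1 hN
    have hall : ∀ k, k = j₀ := fun k => by
      by_contra hk
      exact hj₀ ⟨k, hk⟩
    haveI : Subsingleton (Fin N) := ⟨fun a c => (hall a).trans (hall c).symm⟩
    have h0 : ∀ j, nearestDist y j = 0 := fun j => nearestDist_eq_zero_of_subsingleton y j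
    simp only [h0]
    norm_num
    positivity

/-! ## 3. Dyadic shells: the weighted far field at a site -/

/-- One dyadic shell, weighted: over sites with `R·2ⁿ ≤ dist (y j) p ≤ R·2ⁿ⁺¹`,
`Σ r_j⁻⁶ · min(nn_j,1)³ ≤ 64 (1 + 1/(4R))³ R⁻³ · (1/8)ⁿ`. [folklore] -/
theorem sum_far_weight_shell (y : Fin N → (EuclideanSpace ℝ (Fin 3))) (hsep : ∀ a b : Fin N, a ≠ b → (7 : ℝ) / 10 ≤ dist (y a) (y b))
    (p : (EuclideanSpace ℝ (Fin 3))) {R : ℝ} (hR : 0 < R) (n : ℕ) (F : Finset (Fin N))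
    (hlo : ∀ j ∈ F, R * 2 ^ n ≤ dist (y j) p) (hhi : ∀ j ∈ F, dist (y j) p ≤ R * 2 ^ (n + 1)) :
    ∑ j ∈ F, (dist (y j) p)⁻¹ ^ 6 * (min (nearestDist y j) 1) ^ 3 ≤
      64 * (1 + 1 / (4 * R)) ^ 3 / R ^ 3 * (1 / 8) ^ n := by
  set M : ℝ := R * 2 ^ n with hM
  have hMpos : 0 < M := by positivity
  -- weighted count by packing in the ball of radius `2M + 1/2`
  have hW : ∑ j ∈ F, (min (nearestDist y j) 1) ^ 3 ≤ 8 * (R * 2 ^ (n + 1) + 1 / 2) ^ 3 :=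
    sum_weight_le_of_dist_le y hsep p (by positivity) F hhi
  -- each inverse power
  have hterm : ∀ j ∈ F, (dist (y j) p)⁻¹ ^ 6 * (min (nearestDist y j) 1) ^ 3 ≤
      (M⁻¹) ^ 6 * (min (nearestDist y j) 1) ^ 3 := by
    intro j hj
    have hlo' := hlo j hj
    have hdpos : 0 < dist (y j) p := hMpos.trans_le hlo'
    have hw : 0 ≤ (min (nearestDist y j) 1) ^ 3 := pow_nonneg (le_min (nearestDist_nonneg y j) zero_le_one) 3
    exact mul_le_mul_of_nonneg_right (pow_le_pow_left₀ (inv_nonneg.2 hdpos.le) (inv_anti₀ hMpos hlo') _) hw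
  have h2M : R * 2 ^ (n + 1) + 1 / 2 ≤ 2 * M * (1 + 1 / (4 * R)) := by
    have h2n : (1 : ℝ) ≤ 2 ^ n := one_le_pow₀ (by norm_num)
    have : 2 * M * (1 + 1 / (4 * R)) = R * 2 ^ (n + 1) + 2 ^ n / 2 := by
      rw [hM, pow_succ]; field_simp; ring
    rw [this]; linarith
  have hcube : (R * 2 ^ (n + 1) + 1 / 2) ^ 3 ≤ (2 * M * (1 + 1 / (4 * R))) ^ 3 :=
    pow_le_pow_left₀ (by positivity) h2M 3
  calc ∑ j ∈ F, (dist (y j) p)⁻¹ ^ 6 * (min (nearestDist y j) 1) ^ 3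
      ≤ ∑ j ∈ F, (M⁻¹) ^ 6 * (min (nearestDist y j) 1) ^ 3 := Finset.sum_le_sum hterm
    _ = (M⁻¹) ^ 6 * ∑ j ∈ F, (min (nearestDist y j) 1) ^ 3 := by rw [Finset.mul_sum]
    _ ≤ (M⁻¹) ^ 6 * (8 * (2 * M * (1 + 1 / (4 * R))) ^ 3) :=
        mul_le_mul_of_nonneg_left (hW.trans (by linarith)) (by positivity)
    _ = 64 * (1 + 1 / (4 * R)) ^ 3 / R ^ 3 * (1 / 8) ^ n := by
        have h8 : (1 / 8 : ℝ) ^ n = ((2 : ℝ) ^ n)⁻¹ ^ 3 := by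
          rw [← inv_pow, ← pow_mul, show (1 / 8 : ℝ) = 2⁻¹ ^ 3 by norm_num, ← pow_mul, mul_comm]
        have h2 : (2 : ℝ) ^ n ≠ 0 := by positivity
        rw [h8, hM]
        field_simp
        ring

/-- **The weighted far field at a site** (dyadic shells + weighted packing): for `R > 0` and any centre `p`,
`Σ_{j : dist (y j) p ≥ R} r_j⁻⁶ · min(nn_j,1)³ ≤ (512/7) (1 + 1/(4R))³ / R³`. [folklore] -/
theorem sum_far_weight_le (y : Fin N → (EuclideanSpace ℝ (Fin 3))) (hsep : ∀ a b : Fin N, a ≠ b → (7 : ℝ) / 10 ≤ dist (y a) (y b))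
    (p : (EuclideanSpace ℝ (Fin 3))) {R : ℝ} (hR : 0 < R) (s : Finset (Fin N)) (hfar : ∀ j ∈ s, R ≤ dist (y j) p) :
    ∑ j ∈ s, (dist (y j) p)⁻¹ ^ 6 * (min (nearestDist y j) 1) ^ 3 ≤ 512 / 7 * (1 + 1 / (4 * R)) ^ 3 / R ^ 3 := by
  classical
  have key : ∀ j ∈ s, ∃ n : ℕ, R * 2 ^ n ≤ dist (y j) p ∧ dist (y j) p ≤ R * 2 ^ (n + 1) := by
    intro j hj
    have h1 : 1 ≤ dist (y j) p / R := by
      rw [le_div_iff₀ hR, one_mul]; exact hfar j hj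
    obtain ⟨n, hn, hn'⟩ := exists_nat_pow_near h1 one_lt_two
    refine ⟨n, ?_, ?_⟩
    · rw [le_div_iff₀ hR] at hn; linarith
    · rw [div_lt_iff₀ hR] at hn'; linarith
  choose! idx hidx using key
  have hmaps : ∀ j ∈ s, idx j ∈ s.image idx := fun j hj => Finset.mem_image_of_mem idx hj
  rw [← Finset.sum_fiberwise_of_maps_to hmaps]
  set C : ℝ := 64 * (1 + 1 / (4 * R)) ^ 3 / R ^ 3 with hC
  have hC0 : 0 ≤ C := by positivity
  have fiber : ∀ n ∈ s.image idx,
      ∑ j ∈ s with idx j = n, (dist (y j) p)⁻¹ ^ 6 * (min (nearestDist y j) 1) ^ 3 ≤ C * (1 / 8) ^ n := by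
    intro n _
    refine sum_far_weight_shell y hsep p hR n _ ?_ ?_
    · intro j hj
      obtain ⟨hj', hn⟩ := Finset.mem_filter.1 hj
      rw [← hn]
      exact (hidx j hj').1
    · intro j hj
      obtain ⟨hj', hn⟩ := Finset.mem_filter.1 hj
      rw [← hn]
      exact (hidx j hj').2
  have hgeom : HasSum (fun n : ℕ => C * (1 / 8 : ℝ) ^ n) (C * (1 - 1 / 8)⁻¹) :=
    (hasSum_geometric_of_lt_one (by norm_num) (by norm_num)).mul_left _
  calc ∑ n ∈ s.image idx, ∑ j ∈ s with idx j = n, (dist (y j) p)⁻¹ ^ 6 * (min (nearestDist y j) 1) ^ 3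
      ≤ ∑ n ∈ s.image idx, C * (1 / 8 : ℝ) ^ n := Finset.sum_le_sum fiber
    _ ≤ C * (1 - 1 / 8)⁻¹ := sum_le_hasSum _ (fun n _ => by positivity) hgeom
    _ = 512 / 7 * (1 + 1 / (4 * R)) ^ 3 / R ^ 3 := by rw [hC]; norm_num; ring


/-! ## 4. Symmetrisation and the tail floor -/

/-- `V_LJ(r) ≥ −r⁻⁶/6`. [folklore] -/
theorem lennardJones_ge (r : ℝ) : -((1 : ℝ) / 6 * (r⁻¹) ^ 6) ≤ lennardJones r := by
  unfold lennardJones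
  have : 0 ≤ (r⁻¹) ^ 12 := by positivity
  linarith

/-- **Pointwise symmetrised bound** (AM–GM with `w_i m_i = 1`): with `w = min(nn,1)³`, `m = w⁻¹` and `d = dist (y i) (y k)`,
`tailLJ R d ≥ −(1/12)·(𝟙[d ≥ R] d⁻⁶ w_k · m_i + 𝟙[d ≥ R] d⁻⁶ w_i · m_k)`. [folklore] -/
theorem tail_pair_ge (y : Fin N → (EuclideanSpace ℝ (Fin 3))) (hsep : ∀ a b : Fin N, a ≠ b → (7 : ℝ) / 10 ≤ dist (y a) (y b))
    {R : ℝ} (hR : 0 < R) (i k : Fin N) :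
    -((1 : ℝ) / 12 *
        ((if R ≤ dist (y k) (y i) then (dist (y k) (y i))⁻¹ ^ 6 * (min (nearestDist y k) 1) ^ 3 else 0) *
            ((min (nearestDist y i) 1) ^ 3)⁻¹ +
          (if R ≤ dist (y i) (y k) then (dist (y i) (y k))⁻¹ ^ 6 * (min (nearestDist y i) 1) ^ 3 else 0) *
            ((min (nearestDist y k) 1) ^ 3)⁻¹)) ≤
      (if dist (y i) (y k) < R then 0 else lennardJones (dist (y i) (y k))) := by
  by_cases hfar : R ≤ dist (y i) (y k)
  · have hfar' : R ≤ dist (y k) (y i) := by rw [dist_comm]; exact hfar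
    have hik : i ≠ k := by
      intro h; rw [h, dist_self] at hfar; linarith
    rw [if_pos hfar', if_pos hfar, if_neg (not_lt.2 hfar), dist_comm (y k) (y i)]
    set d : ℝ := dist (y i) (y k) with hd
    set wi : ℝ := (min (nearestDist y i) 1) ^ 3 with hwi
    set wk : ℝ := (min (nearestDist y k) 1) ^ 3 with hwk
    have hwi0 : 0 < wi := pow_pos (lt_min (by linarith [nearestDist_ge y hsep ⟨k, Ne.symm hik⟩]) one_pos) 3
    have hwk0 : 0 < wk := pow_pos (lt_min (by linarith [nearestDist_ge y hsep ⟨i, hik⟩]) one_pos) 3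
    have hamgm : 2 ≤ wk * wi⁻¹ + wi * wk⁻¹ := by
      have : wk * wi⁻¹ + wi * wk⁻¹ - 2 = (wk - wi) ^ 2 / (wi * wk) := by
        field_simp; ring
      have h0 : 0 ≤ (wk - wi) ^ 2 / (wi * wk) := by positivity
      linarith
    have h6 : 0 ≤ (d⁻¹) ^ 6 := by positivity
    have hV := lennardJones_ge d
    calc -(1 / 12 * ((d⁻¹) ^ 6 * wk * wi⁻¹ + (d⁻¹) ^ 6 * wi * wk⁻¹))
        = -(1 / 12 * (d⁻¹) ^ 6 * (wk * wi⁻¹ + wi * wk⁻¹)) := by ring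
      _ ≤ -(1 / 12 * (d⁻¹) ^ 6 * 2) := by nlinarith
      _ = -(1 / 6 * (d⁻¹) ^ 6) := by ring
      _ ≤ lennardJones d := hV
  · have hfar' : ¬ R ≤ dist (y k) (y i) := by rw [dist_comm]; exact hfar
    rw [if_neg hfar', if_neg hfar, if_pos (not_le.1 hfar)]
    simp

/-- **THE TAIL FLOOR** (raw form of lens-5 g33's `TailFloor R A_R`): over every `7/10`-separated finite cluster and for every `R > 0`,
`−A_R · Σ_i min(nn_i,1)⁻³ ≤ Σ_{i<j} tailLJ R (r_ij)` with `A_R = (128/21)(1 + 1/(4R))³ / R³`. [folklore] -/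
theorem tail_floor {R : ℝ} (hR : 0 < R) (N : ℕ) (y : Fin N → (EuclideanSpace ℝ (Fin 3)))
    (hsep : ∀ a b : Fin N, a ≠ b → (7 : ℝ) / 10 ≤ dist (y a) (y b)) :
    -(128 / 21 * (1 + 1 / (4 * R)) ^ 3 / R ^ 3 * ∑ i, ((min (nearestDist y i) 1) ^ 3)⁻¹) ≤
      interactionEnergy (fun r => if r < R then 0 else lennardJones r) y := by
  classical
  set C : ℝ := 512 / 7 * (1 + 1 / (4 * R)) ^ 3 / R ^ 3 with hC
  set w : Fin N → ℝ := fun j => (min (nearestDist y j) 1) ^ 3 with hw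
  set m : Fin N → ℝ := fun j => ((min (nearestDist y j) 1) ^ 3)⁻¹ with hm
  have hm0 : ∀ j, 0 ≤ m j := fun j => inv_nonneg.2 (pow_nonneg (le_min (nearestDist_nonneg y j) zero_le_one) 3)
  -- the weighted far field at every site is `≤ C`
  have hS : ∀ i : Fin N, ∑ k, (if R ≤ dist (y k) (y i) then (dist (y k) (y i))⁻¹ ^ 6 * w k else 0) ≤ C := by
    intro i
    rw [← Finset.sum_filter]
    exact sum_far_weight_le y hsep (y i) hR _ fun k hk => (Finset.mem_filter.1 hk).2
  -- double counting: `2 U = Σ_i Σ_{k ≠ i} tailLJ`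
  have h2 := two_mul_interactionEnergy (fun r => if r < R then 0 else lennardJones r) y
  have hsite : ∀ i : Fin N, siteEnergy (fun r => if r < R then 0 else lennardJones r) y i =
      ∑ k, (if dist (y i) (y k) < R then 0 else lennardJones (dist (y i) (y k))) := by
    intro i
    unfold siteEnergy
    exact Finset.sum_erase _ (by simp [hR])
  -- the symmetrised lower bound, summed (the two halves are the same sum with the indices renamed)
  have hsum : -(1 / 12 * (∑ i, m i * ∑ k, (if R ≤ dist (y k) (y i) then (dist (y k) (y i))⁻¹ ^ 6 * w k else 0) +
      ∑ i, m i * ∑ k, (if R ≤ dist (y k) (y i) then (dist (y k) (y i))⁻¹ ^ 6 * w k else 0))) ≤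
      ∑ i, ∑ k, (if dist (y i) (y k) < R then 0 else lennardJones (dist (y i) (y k))) := by
    have hpt := fun i k => tail_pair_ge y hsep hR i k
    have e1 : ∑ i, m i * ∑ k, (if R ≤ dist (y k) (y i) then (dist (y k) (y i))⁻¹ ^ 6 * w k else 0) =
        ∑ i, ∑ k, (if R ≤ dist (y k) (y i) then (dist (y k) (y i))⁻¹ ^ 6 * w k else 0) * m i := by
      refine Finset.sum_congr rfl fun i _ => ?_
      rw [Finset.mul_sum]
      exact Finset.sum_congr rfl fun k _ => by ring
    have e2 : ∑ i, ∑ k, (if R ≤ dist (y i) (y k) then (dist (y i) (y k))⁻¹ ^ 6 * w i else 0) * m k =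
        ∑ i, ∑ k, (if R ≤ dist (y k) (y i) then (dist (y k) (y i))⁻¹ ^ 6 * w k else 0) * m i :=
      Finset.sum_comm
    have e3 : ∑ i, ∑ k, -((1 : ℝ) / 12 *
        ((if R ≤ dist (y k) (y i) then (dist (y k) (y i))⁻¹ ^ 6 * w k else 0) * m i +
          (if R ≤ dist (y i) (y k) then (dist (y i) (y k))⁻¹ ^ 6 * w i else 0) * m k)) =
        -(1 / 12 * (∑ i, ∑ k, (if R ≤ dist (y k) (y i) then (dist (y k) (y i))⁻¹ ^ 6 * w k else 0) * m i +
          ∑ i, ∑ k, (if R ≤ dist (y i) (y k) then (dist (y i) (y k))⁻¹ ^ 6 * w i else 0) * m k)) := by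
      rw [← Finset.sum_add_distrib, Finset.mul_sum, ← Finset.sum_neg_distrib]
      refine Finset.sum_congr rfl fun i _ => ?_
      rw [← Finset.sum_add_distrib, Finset.mul_sum, ← Finset.sum_neg_distrib]
    calc -(1 / 12 * (∑ i, m i * ∑ k, (if R ≤ dist (y k) (y i) then (dist (y k) (y i))⁻¹ ^ 6 * w k else 0) +
          ∑ i, m i * ∑ k, (if R ≤ dist (y k) (y i) then (dist (y k) (y i))⁻¹ ^ 6 * w k else 0)))
        = -(1 / 12 * (∑ i, ∑ k, (if R ≤ dist (y k) (y i) then (dist (y k) (y i))⁻¹ ^ 6 * w k else 0) * m i +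
          ∑ i, ∑ k, (if R ≤ dist (y i) (y k) then (dist (y i) (y k))⁻¹ ^ 6 * w i else 0) * m k)) := by
          rw [e1, e2]
      _ = _ := e3.symm
      _ ≤ ∑ i, ∑ k, (if dist (y i) (y k) < R then 0 else lennardJones (dist (y i) (y k))) :=
          Finset.sum_le_sum fun i _ => Finset.sum_le_sum fun k _ => hpt i k
  -- bound the weighted far field by `C`
  have hA : ∑ i, m i * ∑ k, (if R ≤ dist (y k) (y i) then (dist (y k) (y i))⁻¹ ^ 6 * w k else 0) ≤ C * ∑ i, m i := by
    rw [Finset.mul_sum]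
    refine Finset.sum_le_sum fun i _ => ?_
    rw [mul_comm C]
    exact mul_le_mul_of_nonneg_left (hS i) (hm0 i)
  have hU : 2 * interactionEnergy (fun r => if r < R then 0 else lennardJones r) y =
      ∑ i, ∑ k, (if dist (y i) (y k) < R then 0 else lennardJones (dist (y i) (y k))) := by
    rw [h2]; exact Finset.sum_congr rfl fun i _ => hsite i
  have hfin : -(1 / 12 * (C * ∑ i, m i + C * ∑ i, m i)) ≤ 2 * interactionEnergy (fun r => if r < R then 0 else lennardJones r) y := by
    rw [hU]
    refine le_trans ?_ hsum
    have := add_le_add hA hA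
    linarith
  have hCm : 128 / 21 * (1 + 1 / (4 * R)) ^ 3 / R ^ 3 * ∑ i, ((min (nearestDist y i) 1) ^ 3)⁻¹ = 1 / 12 * C * ∑ i, m i := by
    rw [hC]; ring
  rw [hCm]
  linarith

/-- Literal at `R = 8`: `A_8 = (128/21)(33/32)³/512 ≤ 131/10⁴` — the instance that BITES beneath lens-5 g33's `T′` ceiling `1.6·10⁻²`
(`131/10⁴ · s⋆⁻³ ≈ 1.43·10⁻²`). [folklore] -/
theorem tail_floor_eight (N : ℕ) (y : Fin N → (EuclideanSpace ℝ (Fin 3))) (hsep : ∀ a b : Fin N, a ≠ b → (7 : ℝ) / 10 ≤ dist (y a) (y b)) :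
    -(131 / 10000 * ∑ i, ((min (nearestDist y i) 1) ^ 3)⁻¹) ≤
      interactionEnergy (fun r => if r < 8 then 0 else lennardJones r) y := by
  have h := tail_floor (R := 8) (by norm_num) N y hsep
  have hs : 0 ≤ ∑ i, ((min (nearestDist y i) 1) ^ 3)⁻¹ :=
    Finset.sum_nonneg fun i _ => inv_nonneg.2 (pow_nonneg (le_min (nearestDist_nonneg y i) zero_le_one) 3)
  have hc : (128 : ℝ) / 21 * (1 + 1 / (4 * 8)) ^ 3 / 8 ^ 3 ≤ 131 / 10000 := by norm_num
  nlinarith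

/-- Literal at `R = 14`: `A_14 ≤ 1/400` — the instance that bites beneath the `FDG` ceiling `3.6·10⁻³` of lens-5 g33's unsplit range cut
(`(1/400)·s⋆⁻³ ≈ 2.7·10⁻³`). [folklore] -/
theorem tail_floor_fourteen (N : ℕ) (y : Fin N → (EuclideanSpace ℝ (Fin 3))) (hsep : ∀ a b : Fin N, a ≠ b → (7 : ℝ) / 10 ≤ dist (y a) (y b)) :
    -(1 / 400 * ∑ i, ((min (nearestDist y i) 1) ^ 3)⁻¹) ≤
      interactionEnergy (fun r => if r < 14 then 0 else lennardJones r) y := by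
  have h := tail_floor (R := 14) (by norm_num) N y hsep
  have hs : 0 ≤ ∑ i, ((min (nearestDist y i) 1) ^ 3)⁻¹ :=
    Finset.sum_nonneg fun i _ => inv_nonneg.2 (pow_nonneg (le_min (nearestDist_nonneg y i) zero_le_one) 3)
  have hc : (128 : ℝ) / 21 * (1 + 1 / (4 * 14)) ^ 3 / 14 ^ 3 ≤ 1 / 400 := by norm_num
  nlinarith

end Summit.AtomisticToContinuum.Crystallization.Theorems.FrustratedLawDichotomyTailFloor
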